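import Literature.NumberTheory.EllipticCurves.PAdicLFunctionIntegralityAtTwoProofs
import Summits.BirchSwinnertonDyer.BirchSwinnertonDyer.Theorems.AlignedTransportAtTwoMainConjectureTransportAlignedAtTwoSigmaRaw
import HarnessLib

/-!
# Route `AlignedTransportAtTwo`, crux C1 `MainConjectureTransportAlignedAtTwo` (stmt-BirchSwinnertonDyer-22296), line `birth` —
# the SYMBOL-TO-`L`-FUNCTION step at `p = 2`: a mod-`2` congruence of plus modular symbols on the `2`-power cusps forces
# `red G₁ = red G₂` for the integral `2`-adic `L`-functions (hence the `μ`-transfer and `λ₁ = λ₂` at a fixed level)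

HONEST FRAMING (cell `bsd-f1-sign2`, lead seat `bsd-line-att-p1` g3). BSD is NOT proved here and the crux C1 is NOT closed here.
Line `birth` v6 leaves ONE open input, the raw `Σ`-depleted mod-`2` identity of the even-branch `2`-adic `L`-functions of an
aligned pair (`stub_sigmaRawS3`). This file proves, in the kernel and for the tree's OWN objects (Mazur–Tate–Teitelbaum measure
`msdMeasure`, Riemann sums `padicLRiemannSum`, `padicLFunction`, `γ = 5`, `Δ = {±1}`), the step that turns a statement about
MODULAR SYMBOLS into a statement about `2`-adic `L`-FUNCTIONS — the `p = 2` analogue of «Vatsal's congruence of canonical plus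
symbols ⇒ Greenberg–Vatsal (1.4), analytic half» (Vatsal 1999 Thm. 1.13, GV 2000 §3 (18)–(19) and p. 4, printed for `p` odd):

**If two rational newforms `f₁, f₂` (unit roots `α₁, α₂ ∈ ℤ₂ˣ`) have `2`-integrally CONGRUENT rational plus symbols on the
`2`-power cusps, `[m/2ᵏ]⁺_{f₁} − [m/2ᵏ]⁺_{f₂} ∈ ℤ₍₂₎` for all `m, k` — equivalently `2[x]⁺_{f₁} ≡ 2[x]⁺_{f₂} (mod 2)` for the
half-integers `2[x]⁺` of the tree's normalisation — then every coefficient of `L₂(f₁, α₁, T) − L₂(f₂, α₂, T)` lies in `2ℤ₂`,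
so the integral lifts satisfy `red G₁ = red G₂` in `𝔽₂⟦T⟧`; in particular `μ(G₁) = 0 ⇒ μ(G₂) = 0` and `λ(G₁) = λ(G₂)`.**

Mechanism (§2–§4): the symbols are `½ℤ₂`-valued (`norm_ratPlusSymbol_two_le_two`, odd Eisenstein multiple from the
irreducibility of `E[2]`), the unit roots are `≡ 1 (mod 2)` so `α₁⁻ʲ − α₂⁻ʲ ∈ 2ℤ₂` (§1), hence the two measures differ by a
`ℤ₂`-valued function (§2); the `Δ = {±1}`-doubling of every Riemann sum at `p = 2` (`padicLRiemannSum_two`) turns this into a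
difference of Riemann sums in `2ℤ₂`, the sums converge (`tendsto_padicLRiemannSum_of_norm_le`) and `2ℤ₂` is closed (§3); a
power series over `ℤ₂` with all coefficients in `2ℤ₂` reduces to `0` (§4). §5 assembles the curve-level statement for two
globally minimal curves good ordinary at `2` without rational `2`-torsion and their even-branch lifts (`IsEvenBranchLiftAtTwo`).
USE for the line: at a COMMON level the raw `Σ`-identity of `stub_sigmaRawS3` is `red G₁ = red G₂` up to the common non-zero
depletion factor, so on same-level aligned pairs the open input is EXACTLY the symbol parity law of §5's hypothesis `hpar` — an
identity of finitely many rational numbers per layer, the object the cell's census computes (SYMTEST: aligned ⇒ identical mod-2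
symbols 33/33 same-level pairs, 483/483 at scale). Everything here is proved; the parity law itself is NOT asserted.
CONDITIONAL on nothing; `--supports stmt-BirchSwinnertonDyer-22296`; closes nothing.

References: [Vatsal1999] (1.6), Thm. 1.13; [GreenbergVatsal2000] §3 (18)–(19), p. 4, Prop. 3.7; [MazurTateTeitelbaum1986Invent]
§I.10–I.13; [EmertonPollackWeston2006] Thm. 1 (the cross-level version needs the `Σ`-depletion, not done here).
-/

set_option autoImplicit false
set_option linter.dupNamespace false

noncomputable section

open scoped Classical MatrixGroups ModularForm

open CongruenceSubgroup Filter Topology WeierstrassCurve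
open Literature.NumberTheory.EllipticCurves Literature.NumberTheory.EllipticCurves.ModularForms
open Literature.NumberTheory.EllipticCurves.Greenberg1999
open Summit.BirchSwinnertonDyer.Rank1Residual.X1.MuLambda
open Summit.BirchSwinnertonDyer.Rank1Residual.F1Sign2
open Summit.BirchSwinnertonDyer.BirchSwinnertonDyer.Theorems.AlignedTransportAtTwoClosure
open Summit.BirchSwinnertonDyer.BirchSwinnertonDyer.Theorems.AlignedTransportAtTwoSigmaGlue

namespace Summit.BirchSwinnertonDyer.BirchSwinnertonDyer.Theorems.AlignedTransportAtTwoSymbolParity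

/-! ## §1 `2`-adic bookkeeping: units of `ℤ₂` are `≡ 1 (mod 2)` -/

/-- The only unit of `ℤ/2` is `1`. [folklore] -/
theorem eq_one_of_isUnit_zmod_two {z : ZMod 2} (hz : IsUnit z) : z = 1 := by
  fin_cases z
  · exact absurd hz not_isUnit_zero
  · rfl

/-- An element of `ℤ₂` of norm `< 1` has norm `≤ ½`. [folklore] -/
theorem norm_le_half_of_norm_lt_one {x : ℤ_[2]} (h : ‖x‖ < 1) : ‖x‖ ≤ 2⁻¹ := by
  have h' : ‖x‖ < (2 : ℝ) ^ ((-1 : ℤ) + 1) := by norm_num; exact h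
  have := (PadicInt.norm_le_pow_iff_norm_lt_pow_add_one x (-1)).mpr h'
  simpa using this

/-- **Powers of two units of `ℤ₂` are congruent mod `2`**: `‖u⁻ʲ − v⁻ʲ‖ ≤ ½` in `ℚ₂` for `u, v ∈ ℤ₂ˣ` (both reduce to the
only unit `1` of `𝔽₂`). Applied to the unit roots `α₁, α₂` of two curves ordinary at `2`. [folklore] -/
theorem norm_inv_pow_sub_inv_pow_le_half {u v : ℤ_[2]} (hu : IsUnit u) (hv : IsUnit v) (j : ℕ) :
    ‖((u : ℚ_[2]))⁻¹ ^ j - ((v : ℚ_[2]))⁻¹ ^ j‖ ≤ 2⁻¹ := by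
  -- the inverses inside `ℤ₂`
  set u' : ℤ_[2] := ((hu.unit⁻¹ : ℤ_[2]ˣ) : ℤ_[2]) with hu'
  set v' : ℤ_[2] := ((hv.unit⁻¹ : ℤ_[2]ˣ) : ℤ_[2]) with hv'
  have huinv : ((u : ℚ_[2]))⁻¹ = (u' : ℚ_[2]) := by
    have h1 : (u' : ℤ_[2]) * u = 1 := by rw [hu']; exact hu.unit.inv_mul
    have h2 : (u' : ℚ_[2]) * (u : ℚ_[2]) = 1 := by rw [← PadicInt.coe_mul, h1, PadicInt.coe_one]
    exact (eq_inv_of_mul_eq_one_left h2).symm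
  have hvinv : ((v : ℚ_[2]))⁻¹ = (v' : ℚ_[2]) := by
    have h1 : (v' : ℤ_[2]) * v = 1 := by rw [hv']; exact hv.unit.inv_mul
    have h2 : (v' : ℚ_[2]) * (v : ℚ_[2]) = 1 := by rw [← PadicInt.coe_mul, h1, PadicInt.coe_one]
    exact (eq_inv_of_mul_eq_one_left h2).symm
  rw [huinv, hvinv]
  have hcast : (u' : ℚ_[2]) ^ j - (v' : ℚ_[2]) ^ j = ((u' ^ j - v' ^ j : ℤ_[2]) : ℚ_[2]) := by push_cast; rfl
  rw [hcast, PadicInt.padic_norm_e_of_padicInt]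
  apply norm_le_half_of_norm_lt_one
  -- `u'^j − v'^j` reduces to `1 − 1 = 0` in `𝔽₂`
  have hu'u : IsUnit u' := Units.isUnit _
  have hv'u : IsUnit v' := Units.isUnit _
  have hz : PadicInt.toZMod (p := 2) (u' ^ j - v' ^ j) = 0 := by
    rw [map_sub, map_pow, map_pow, eq_one_of_isUnit_zmod_two (hu'u.map _), eq_one_of_isUnit_zmod_two (hv'u.map _),
      one_pow, sub_self]
  have hmem : u' ^ j - v' ^ j ∈ IsLocalRing.maximalIdeal ℤ_[2] := by
    rw [← PadicInt.ker_toZMod]; exact hz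
  exact PadicInt.mem_nonunits.mp ((IsLocalRing.mem_maximalIdeal _).mp hmem)

/-! ## §2 Two measures whose symbols are congruent differ by a `ℤ₂`-valued function -/

section Measure

variable {N₁ N₂ : ℕ} (f₁ : CuspForm (Gamma0 N₁) 2) (f₂ : CuspForm (Gamma0 N₂) 2)

/-- The elementary estimate behind §2: `‖a₁s₁ − a₂s₂‖ ≤ 1` when `‖a₁‖ ≤ 1`, `‖s₁ − s₂‖ ≤ 1`, `‖a₁ − a₂‖ ≤ ½`, `‖s₂‖ ≤ 2`
(write `a₁s₁ − a₂s₂ = a₁(s₁ − s₂) + (a₁ − a₂)s₂`, ultrametric). [folklore] -/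
theorem norm_mul_sub_mul_le_one {a₁ a₂ s₁ s₂ : ℚ_[2]} (ha₁ : ‖a₁‖ ≤ 1) (hs : ‖s₁ - s₂‖ ≤ 1)
    (ha : ‖a₁ - a₂‖ ≤ 2⁻¹) (hs₂ : ‖s₂‖ ≤ 2) : ‖a₁ * s₁ - a₂ * s₂‖ ≤ 1 := by
  have hsplit : a₁ * s₁ - a₂ * s₂ = a₁ * (s₁ - s₂) + (a₁ - a₂) * s₂ := by ring
  rw [hsplit]
  refine (Padic.nonarchimedean _ _).trans (max_le ?_ ?_)
  · rw [norm_mul]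
    calc ‖a₁‖ * ‖s₁ - s₂‖ ≤ 1 * 1 := mul_le_mul ha₁ hs (norm_nonneg _) zero_le_one
      _ = 1 := one_mul _
  · rw [norm_mul]
    calc ‖a₁ - a₂‖ * ‖s₂‖ ≤ 2⁻¹ * 2 := mul_le_mul ha hs₂ (norm_nonneg _) (by norm_num)
      _ = 1 := by norm_num

/-- **Congruent symbols ⇒ congruent measures.** Let `α₁, α₂ ∈ ℤ₂ˣ` (as elements of `ℚ₂`), suppose the rational plus symbols of
`f₂` on the `2`-power cusps have norm `≤ 2` and the two symbol tables are CONGRUENT, `‖[m/2ᵏ]⁺_{f₁} − [m/2ᵏ]⁺_{f₂}‖₂ ≤ 1`. Then at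
every positive level the Mazur–Tate–Teitelbaum measures differ by a `ℤ₂`-valued function:
`‖μ_{f₁,α₁}(a + 2^{n+1}ℤ₂) − μ_{f₂,α₂}(a + 2^{n+1}ℤ₂)‖ ≤ 1`. [cite: MazurTateTeitelbaum1986Invent, §I.10 (10.1)] -/
theorem norm_msdMeasure_sub_le_one {u₁ u₂ : ℤ_[2]} (hu₁ : IsUnit u₁) (hu₂ : IsUnit u₂)
    (hsym₂ : ∀ m k : ℕ, ‖((ratPlusSymbol f₂ ((m : ℚ) / (2 : ℚ) ^ k) : ℚ) : ℚ_[2])‖ ≤ 2)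
    (hpar : ∀ m k : ℕ,
      ‖((ratPlusSymbol f₁ ((m : ℚ) / (2 : ℚ) ^ k) - ratPlusSymbol f₂ ((m : ℚ) / (2 : ℚ) ^ k) : ℚ) : ℚ_[2])‖ ≤ 1)
    (n : ℕ) (a : ZMod (2 ^ (n + 1))) :
    ‖msdMeasure f₁ (u₁ : ℚ_[2]) (n + 1) a - msdMeasure f₂ (u₂ : ℚ_[2]) (n + 1) a‖ ≤ 1 := by
  have hcast : ((2 : ℕ) : ℚ) = (2 : ℚ) := by norm_num
  simp only [msdMeasure, hcast]
  have hα₁ : ‖((u₁ : ℚ_[2]))⁻¹‖ = 1 := by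
    rw [norm_inv, PadicInt.padic_norm_e_of_padicInt, PadicInt.isUnit_iff.mp hu₁, inv_one]
  have hpow : ∀ j : ℕ, ‖((u₁ : ℚ_[2]))⁻¹ ^ j‖ ≤ 1 := fun j ↦ by rw [norm_pow, hα₁, one_pow]
  have hpar' : ∀ m k : ℕ, ‖((ratPlusSymbol f₁ ((m : ℚ) / (2 : ℚ) ^ k) : ℚ) : ℚ_[2]) -
      ((ratPlusSymbol f₂ ((m : ℚ) / (2 : ℚ) ^ k) : ℚ) : ℚ_[2])‖ ≤ 1 := fun m k ↦ by
    have h := hpar m k; push_cast at h ⊢; exact h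
  have hA := norm_mul_sub_mul_le_one (hpow (n + 1)) (hpar' a.val (n + 1))
    (norm_inv_pow_sub_inv_pow_le_half hu₁ hu₂ (n + 1)) (hsym₂ a.val (n + 1))
  have hB := norm_mul_sub_mul_le_one (hpow (n + 2)) (hpar' a.val n)
    (norm_inv_pow_sub_inv_pow_le_half hu₁ hu₂ (n + 2)) (hsym₂ a.val n)
  have hsplit : ((u₁ : ℚ_[2]))⁻¹ ^ (n + 1) * ((ratPlusSymbol f₁ ((a.val : ℚ) / (2 : ℚ) ^ (n + 1)) : ℚ) : ℚ_[2]) -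
        ((u₁ : ℚ_[2]))⁻¹ ^ (n + 2) * ((ratPlusSymbol f₁ ((a.val : ℚ) / (2 : ℚ) ^ n) : ℚ) : ℚ_[2]) -
      (((u₂ : ℚ_[2]))⁻¹ ^ (n + 1) * ((ratPlusSymbol f₂ ((a.val : ℚ) / (2 : ℚ) ^ (n + 1)) : ℚ) : ℚ_[2]) -
        ((u₂ : ℚ_[2]))⁻¹ ^ (n + 2) * ((ratPlusSymbol f₂ ((a.val : ℚ) / (2 : ℚ) ^ n) : ℚ) : ℚ_[2])) =
      (((u₁ : ℚ_[2]))⁻¹ ^ (n + 1) * ((ratPlusSymbol f₁ ((a.val : ℚ) / (2 : ℚ) ^ (n + 1)) : ℚ) : ℚ_[2]) -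
        ((u₂ : ℚ_[2]))⁻¹ ^ (n + 1) * ((ratPlusSymbol f₂ ((a.val : ℚ) / (2 : ℚ) ^ (n + 1)) : ℚ) : ℚ_[2])) +
      -(((u₁ : ℚ_[2]))⁻¹ ^ (n + 2) * ((ratPlusSymbol f₁ ((a.val : ℚ) / (2 : ℚ) ^ n) : ℚ) : ℚ_[2]) -
        ((u₂ : ℚ_[2]))⁻¹ ^ (n + 2) * ((ratPlusSymbol f₂ ((a.val : ℚ) / (2 : ℚ) ^ n) : ℚ) : ℚ_[2])) := by ring
  rw [hsplit]
  refine (Padic.nonarchimedean _ _).trans (max_le hA ?_)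
  rw [norm_neg]; exact hB

end Measure

/-! ## §3 Congruent measures ⇒ congruent coefficients (doubling + limit) -/

section Coeff

variable {N₁ N₂ : ℕ} [NeZero N₁] [NeZero N₂] (f₁ : CuspForm (Gamma0 N₁) 2) (f₂ : CuspForm (Gamma0 N₂) 2)

/-- **Doubled Riemann sums of congruent measures differ by an element of `2ℤ₂`.** If at every level `≥ 1` the two measures differ
by a `ℤ₂`-valued function, then `‖RS₁(k, n) − RS₂(k, n)‖ ≤ ½` for all `k, n`: by the `Δ = {±1}`-doubling at `p = 2`
(`padicLRiemannSum_two`) each Riemann sum is `2 ×` its `η = 1` half. [cite: MazurTateTeitelbaum1986Invent, §I.13 (p = 2: Δ = {±1}, γ = 5)] -/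
theorem norm_padicLRiemannSum_sub_le_half (α₁ α₂ : ℚ_[2])
    (hμ : ∀ (n : ℕ) (a : ZMod (2 ^ (n + 1))), ‖msdMeasure f₁ α₁ (n + 1) a - msdMeasure f₂ α₂ (n + 1) a‖ ≤ 1) (k n : ℕ) :
    ‖padicLRiemannSum f₁ α₁ k n - padicLRiemannSum f₂ α₂ k n‖ ≤ 2⁻¹ := by
  have norm_two : ‖(2 : ℚ_[2])‖ = (2 : ℝ)⁻¹ := by simpa using Padic.norm_p (p := 2)
  rw [padicLRiemannSum_two, padicLRiemannSum_two, ← mul_sub, norm_mul, norm_two, ← Finset.sum_sub_distrib]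
  have hS : ‖∑ s : ZMod (2 ^ n),
      (msdMeasure f₁ α₁ (n + 2) ((cyclotomicGenerator 2 : ZMod (2 ^ (n + 2))) ^ s.val) * (s.val.choose k : ℚ_[2]) -
        msdMeasure f₂ α₂ (n + 2) ((cyclotomicGenerator 2 : ZMod (2 ^ (n + 2))) ^ s.val) * (s.val.choose k : ℚ_[2]))‖ ≤ 1 := by
    refine IsUltrametricDist.norm_sum_le_of_forall_le_of_nonneg zero_le_one fun s _ ↦ ?_
    have hc : ‖((s.val.choose k : ℕ) : ℚ_[2])‖ ≤ 1 := by
      have h := Padic.norm_int_le_one (p := 2) ((s.val.choose k : ℕ) : ℤ)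
      rwa [Int.cast_natCast] at h
    rw [← sub_mul, norm_mul]
    calc _ ≤ (1 : ℝ) * 1 := mul_le_mul (hμ (n + 1) _) hc (norm_nonneg _) zero_le_one
      _ = 1 := one_mul _
  calc (2 : ℝ)⁻¹ * _ ≤ (2 : ℝ)⁻¹ * 1 := by gcongr
    _ = 2⁻¹ := mul_one _

/-- **Congruent measures ⇒ congruent coefficients of the `2`-adic `L`-functions.** Under the distribution relations and
boundedness of both measures (so that the Riemann sums converge to the coefficients, `tendsto_padicLRiemannSum_of_norm_le`) and
the level-wise congruence of §2, every coefficient satisfies `‖[Tᵏ]L₂(f₁,α₁) − [Tᵏ]L₂(f₂,α₂)‖ ≤ ½` (`2ℤ₂` is closed).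
[cite: MazurTateTeitelbaum1986Invent, §I.11–I.13] -/
theorem norm_padicLCoeff_sub_le_half (α₁ α₂ : ℚ_[2])
    (hdist₁ : ∀ (n : ℕ) (a : ZMod (2 ^ n)),
      ∑ b ∈ Finset.univ.filter (fun b : ZMod (2 ^ (n + 1)) ↦
        ZMod.castHom (pow_dvd_pow 2 n.le_succ) (ZMod (2 ^ n)) b = a), msdMeasure f₁ α₁ (n + 1) b = msdMeasure f₁ α₁ n a)
    (hbdd₁ : ∃ C : ℝ, ∀ (n : ℕ) (a : ZMod (2 ^ n)), ‖msdMeasure f₁ α₁ n a‖ ≤ C)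
    (hdist₂ : ∀ (n : ℕ) (a : ZMod (2 ^ n)),
      ∑ b ∈ Finset.univ.filter (fun b : ZMod (2 ^ (n + 1)) ↦
        ZMod.castHom (pow_dvd_pow 2 n.le_succ) (ZMod (2 ^ n)) b = a), msdMeasure f₂ α₂ (n + 1) b = msdMeasure f₂ α₂ n a)
    (hbdd₂ : ∃ C : ℝ, ∀ (n : ℕ) (a : ZMod (2 ^ n)), ‖msdMeasure f₂ α₂ n a‖ ≤ C)
    (hμ : ∀ (n : ℕ) (a : ZMod (2 ^ (n + 1))), ‖msdMeasure f₁ α₁ (n + 1) a - msdMeasure f₂ α₂ (n + 1) a‖ ≤ 1) (k : ℕ) :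
    ‖padicLCoeff f₁ α₁ k - padicLCoeff f₂ α₂ k‖ ≤ 2⁻¹ :=
  le_of_tendsto ((tendsto_padicLRiemannSum_of_norm_le hdist₁ hbdd₁ k).sub
      (tendsto_padicLRiemannSum_of_norm_le hdist₂ hbdd₂ k)).norm
    (Eventually.of_forall fun n ↦ norm_padicLRiemannSum_sub_le_half f₁ f₂ α₁ α₂ hμ k n)

end Coeff

/-! ## §4 Congruent coefficients ⇒ equal reductions of the integral lifts -/

/-- **Two elements of `Λ = ℤ₂⟦T⟧` whose images in `ℚ₂⟦T⟧` are congruent coefficientwise modulo `2ℤ₂` have the same reduction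
in `𝔽₂⟦T⟧`.** [folklore] -/
theorem red_eq_of_norm_coeff_sub_le_half {G₁ G₂ : IwasawaAlgebra 2}
    (h : ∀ k : ℕ, ‖PowerSeries.coeff k (iwasawaToPowerSeries 2 G₁) - PowerSeries.coeff k (iwasawaToPowerSeries 2 G₂)‖ ≤ 2⁻¹) :
    red G₁ = red G₂ := by
  rw [← sub_eq_zero, ← map_sub]
  ext k
  rw [PowerSeries.coeff_map, map_zero, IsLocalRing.residue_eq_zero_iff, IsLocalRing.mem_maximalIdeal, PadicInt.mem_nonunits]
  have hk := h k
  rw [PowerSeries.coeff_map, PowerSeries.coeff_map, PadicInt.algebraMap_apply, PadicInt.algebraMap_apply, ← PadicInt.coe_sub,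
    PadicInt.padic_norm_e_of_padicInt, ← map_sub] at hk
  exact hk.trans_lt (by norm_num)

/-! ## §5 Assembly for two curves good ordinary at `2` without rational `2`-torsion -/

section Curves

variable {N₁ N₂ : ℕ} [NeZero N₁] [NeZero N₂] {f₁ : CuspForm (Gamma0 N₁) 2} {f₂ : CuspForm (Gamma0 N₂) 2}
  (W₁ : WeierstrassCurve ℚ) [W₁.IsElliptic] [W₁.IsGloballyMinimal]
  (W₂ : WeierstrassCurve ℚ) [W₂.IsElliptic] [W₂.IsGloballyMinimal]

/-- **SYMBOL PARITY ⇒ `red G₁ = red G₂` (p = 2; Vatsal ⇒ Greenberg–Vatsal (1.4), analytic half, fixed level, RAW form).** Let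
`W₁, W₂/ℚ` be globally minimal, good ordinary at `2`, without rational point of order `2` (so `E[2]` irreducible and the
`2`-adic `L`-functions are integral, `padicLFunction_integral_two`), with newforms `f₁, f₂` (any levels) and integral even-branch
lifts `G₁, G₂` of `L₂(f₁, α₁)`, `L₂(f₂, α₂)`. If the rational plus symbols are `2`-integrally congruent on the `2`-power cusps,
`[m/2ᵏ]⁺_{f₁} − [m/2ᵏ]⁺_{f₂} ∈ ℤ₍₂₎` for all `m, k` (`hpar`), then `red G₁ = red G₂` in `𝔽₂⟦T⟧`. The congruence hypothesis
is the raw (un-normalised) form of the cell's IMC-SYMB at the `2`-power cusps; it is NOT asserted here.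
[cite: Vatsal1999, Thm. 1.13] [cite: GreenbergVatsal2000, §3 (18)–(19) and p. 4] [cite: MazurTateTeitelbaum1986Invent, §I.10–I.13] -/
theorem red_eq_of_symbolParity_two (hord₁ : IsOrdinaryAt W₁ 2) (hord₂ : IsOrdinaryAt W₂ 2)
    (ht₁ : ∀ x : ℚ, ¬ HasRationalTwoTorsionX W₁ x) (ht₂ : ∀ x : ℚ, ¬ HasRationalTwoTorsionX W₂ x)
    (hf₁ : IsNewformOf W₁ f₁) (hf₂ : IsNewformOf W₂ f₂)
    (hpar : ∀ m k : ℕ,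
      ‖((ratPlusSymbol f₁ ((m : ℚ) / (2 : ℚ) ^ k) - ratPlusSymbol f₂ ((m : ℚ) / (2 : ℚ) ^ k) : ℚ) : ℚ_[2])‖ ≤ 1)
    {G₁ G₂ : IwasawaAlgebra 2} (hG₁ : IsEvenBranchLiftAtTwo W₁ f₁ G₁) (hG₂ : IsEvenBranchLiftAtTwo W₂ f₂ G₂) :
    red G₁ = red G₂ := by
  have hι₁ := iwasawaToPowerSeries_eq_of_isEvenBranchLiftAtTwo_of_isOrdinaryAt W₁ hord₁ hG₁
  have hι₂ := iwasawaToPowerSeries_eq_of_isEvenBranchLiftAtTwo_of_isOrdinaryAt W₂ hord₂ hG₂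
  have hirr₂ := irr_two_of_forall_not_hasRationalTwoTorsionX W₂ ht₂
  have hirr₁ := irr_two_of_forall_not_hasRationalTwoTorsionX W₁ ht₁
  -- the odd Eisenstein multiple for `f₂` and the symbol bound `‖[x]⁺_{f₂}‖ ≤ 2` on `2`-power cusps
  obtain ⟨n₀, h2n₀, h0⟩ := exists_intCast_mul_modularSymbol_zero_mem (p := 2)
    not_irreducible_of_frobeniusTrace_congr_holds hf₂ hirr₂
  have hpN₂ : ¬ 2 ∣ N₂ := not_dvd_level_of_isNewformOf hf₂ hord₂.1
  have hreal₂ : ∀ n, (cuspCoeff f₂ n).im = 0 := cuspCoeff_im_eq_zero_of_coeffField_eq_bot hf₂.coeffField_eq_bot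
  have hsym₂ : ∀ m k : ℕ, ‖((ratPlusSymbol f₂ ((m : ℚ) / (2 : ℚ) ^ k) : ℚ) : ℚ_[2])‖ ≤ 2 := by
    intro m k
    have h := norm_ratPlusSymbol_two_le_two f₂ hreal₂ h2n₀ h0 (coprime_den_div_prime_pow hpN₂ m k)
    exact_mod_cast h
  -- the same for `f₁` (only its boundedness is needed, for convergence)
  obtain ⟨n₁, h2n₁, h1⟩ := exists_intCast_mul_modularSymbol_zero_mem (p := 2)
    not_irreducible_of_frobeniusTrace_congr_holds hf₁ hirr₁
  -- units
  have hu₁ : IsUnit (unitRoot W₁ 2) := (unitRoot_spec_holds W₁ 2 hord₁).2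
  have hu₂ : IsUnit (unitRoot W₂ 2) := (unitRoot_spec_holds W₂ 2 hord₂).2
  -- §2: the measures differ by a `ℤ₂`-valued function
  have hμ := norm_msdMeasure_sub_le_one f₁ f₂ hu₁ hu₂ hsym₂ hpar
  -- §3: coefficients
  have hcoeff : ∀ k, ‖PowerSeries.coeff k (iwasawaToPowerSeries 2 G₁) - PowerSeries.coeff k (iwasawaToPowerSeries 2 G₂)‖ ≤ 2⁻¹ := by
    intro k
    rw [hι₁, hι₂, coeff_padicLFunction, coeff_padicLFunction]
    exact norm_padicLCoeff_sub_le_half f₁ f₂ _ _ (msdMeasure_distribution_of_isNewformOf hord₁ hf₁)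
      ⟨2, norm_msdMeasure_two_le_two hord₁ hf₁ h2n₁ h1⟩ (msdMeasure_distribution_of_isNewformOf hord₂ hf₂)
      ⟨2, norm_msdMeasure_two_le_two hord₂ hf₂ h2n₀ h0⟩ hμ k
  -- §4
  exact red_eq_of_norm_coeff_sub_le_half hcoeff

/-- **Corollary: the `μ`-TRANSFER and `λ`-EQUALITY at a fixed level from symbol parity** (the fixed-level IMC-LINE with no
`e`-terms, both halves, from the RAW symbol congruence — compare the cell's `lam_eq_of_symbolLineTransferAtTwo`, which gets the
`λ`-half from the unit-normalised statement and carries no `μ`-information): if `μ(G₁) = 0` then `μ(G₂) = 0` and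
`λ(G₁) = λ(G₂)`. [cite: GreenbergVatsal2000, Thm. (1.4) and p. 4] -/
theorem muTransfer_and_lam_eq_of_symbolParity_two (hord₁ : IsOrdinaryAt W₁ 2) (hord₂ : IsOrdinaryAt W₂ 2)
    (ht₁ : ∀ x : ℚ, ¬ HasRationalTwoTorsionX W₁ x) (ht₂ : ∀ x : ℚ, ¬ HasRationalTwoTorsionX W₂ x)
    (hf₁ : IsNewformOf W₁ f₁) (hf₂ : IsNewformOf W₂ f₂)
    (hpar : ∀ m k : ℕ,
      ‖((ratPlusSymbol f₁ ((m : ℚ) / (2 : ℚ) ^ k) - ratPlusSymbol f₂ ((m : ℚ) / (2 : ℚ) ^ k) : ℚ) : ℚ_[2])‖ ≤ 1)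
    {G₁ G₂ : IwasawaAlgebra 2} (hG₁ : IsEvenBranchLiftAtTwo W₁ f₁ G₁) (hG₂ : IsEvenBranchLiftAtTwo W₂ f₂ G₂)
    (hμ₁ : red G₁ ≠ 0) : red G₂ ≠ 0 ∧ lam G₁ = lam G₂ := by
  have h := red_eq_of_symbolParity_two W₁ W₂ hord₁ hord₂ ht₁ ht₂ hf₁ hf₂ hpar hG₁ hG₂
  have hμ₂ : red G₂ ≠ 0 := h ▸ hμ₁
  refine ⟨hμ₂, ?_⟩
  unfold lam
  rw [pfree_eq_self_of_red_ne_zero hμ₁, pfree_eq_self_of_red_ne_zero hμ₂, h]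

end Curves

end Summit.BirchSwinnertonDyer.BirchSwinnertonDyer.Theorems.AlignedTransportAtTwoSymbolParity

end
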